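import Literature.Analysis.Calculus.HadamardLemma
import HarnessLib

/-!
# The linearisation isotopy `G_t(x, y) = t⁻¹ g(x, t y)` of a map vanishing on `y = 0`

Topic `Literature/Analysis/Calculus`; the analytic core of the **uniqueness of tubular
neighbourhoods** (Kosinski, *Differential Manifolds* (1993), III (3.1), p. 47): for a tubular
neighbourhood read in local coordinates as `(x, y) ↦ (f (x, y), g (x, y))` with `f (x, 0) = x`,
`g (x, 0) = 0`, the family `G_t (x, y) = (f (x, t y), t⁻¹ g (x, t y))`, `t ≠ 0`, *"is smooth and
well-defined for all `t`"* because, by Hadamard's lemma (A, 2.1),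
`g (x, y) = Σⱼ aⱼ (x, y) yⱼ` with `aⱼ (x, 0) = ∂g/∂yⱼ (x, 0)`, so that
`t⁻¹ g (x, t y) = Σⱼ aⱼ (x, t y) yⱼ`; and `G_0` is the fibrewise linear map `y ↦ ∂_y g (x, 0) y`.
(Needed by the roadmap of `Literature/Topology/FourManifolds/PresentationHandlebodyFiveProofs.lean`
and by the isotopy invariance of 2-handle attachment, `Geometry/Symplectic/TwoHandleIsotopy.lean`:
the tube germ of an attaching map is unique up to a fibrewise linear map.)

We use the integral form of Hadamard's lemma, which needs no coordinates:

* `Literature.Analysis.Calculus.linearisation g t (x, y) = ∫₀¹ Dg (x, s t y) (0, y) ds`;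
* `Literature.Analysis.Calculus.smul_linearisation` — `t • linearisation g t (x, y) = g (x, t y)`
  when `g (x, 0) = 0` (fundamental theorem of calculus along `s ↦ g (x, s t y)`), so that
  `linearisation g t (x, y) = t⁻¹ g (x, t y)` for `t ≠ 0` (`linearisation_of_ne_zero`) and
  `linearisation g 1 = g` (`linearisation_one`);
* `Literature.Analysis.Calculus.linearisation_zero` — `linearisation g 0 (x, y) = Dg (x, 0) (0, y)`,
  linear in `y` (`linearisationZeroCLM`);
* `Literature.Analysis.Calculus.contDiff_linearisation` — **`(t, x, y) ↦ linearisation g t (x, y)`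
  is `C^∞` on all of `ℝ × E × F`** for `C^∞` `g` and finite-dimensional `E`, `F`
  (differentiation under the integral sign, the tree's `contDiff_intervalIntegral`);
* `Literature.Analysis.Calculus.linearisation_apply_zero` — every stage fixes `E × {0}`;
* `Literature.Analysis.Calculus.injective_fderiv_snd_of_slice` — the rank computation of the
  proof of III (3.1): if `ι = (f, g)` has injective differential at `(x, 0)` and `f (x, 0) = x`,
  `g (x, 0) = 0` for all `x`, then `y ↦ Dg (x, 0) (0, y)` is injective.

Everything here is proved; no named facts are introduced.

## References

* A. A. Kosinski, *Differential Manifolds*, Academic Press (1993), III (3.1) and its proof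
  (p. 47), Appendix (2.1) (Hadamard's lemma). [Kosinski1993]
* M. W. Hirsch, *Differential Topology*, GTM 33 (1976), Ch. 4 §5, Thm. 5.3 (uniqueness of tubular
  neighbourhoods, same device). [HirschDT1976]
-/

open Set Function Filter MeasureTheory intervalIntegral
open scoped Topology ContDiff

noncomputable section

namespace Literature.Analysis.Calculus

variable {E F G : Type*} [NormedAddCommGroup E] [NormedSpace ℝ E] [NormedAddCommGroup F]
  [NormedSpace ℝ F] [NormedAddCommGroup G] [NormedSpace ℝ G]

/-! ### The linearisation family -/

/-- **Kosinski's linearisation family** of a map `g : E × F → G` in the `F`-variable: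
`linearisation g t (x, y) = ∫₀¹ Dg (x, s t y) (0, y) ds`, which equals `t⁻¹ g (x, t y)` for `t ≠ 0`
when `g (x, 0) = 0` (`linearisation_of_ne_zero`) and `Dg (x, 0) (0, y)` for `t = 0`
(`linearisation_zero`). [cite: Kosinski1993, III (3.1), proof (p. 47)] -/
def linearisation (g : E × F → G) (t : ℝ) (p : E × F) : G :=
  ∫ s in (0 : ℝ)..1, fderiv ℝ g (p.1, (s * t) • p.2) ((0 : E), p.2)

/-- The integrand of the linearisation family is continuous in `s` for `C¹` data. [folklore] -/
theorem continuous_linearisation_integrand {g : E × F → G} {n : WithTop ℕ∞} (hg : ContDiff ℝ n g)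
    (hn : n ≠ 0) (t : ℝ) (p : E × F) :
    Continuous fun s : ℝ => fderiv ℝ g (p.1, (s * t) • p.2) ((0 : E), p.2) :=
  ((hg.continuous_fderiv hn).comp (by fun_prop)).clm_apply continuous_const

/-- **`t • linearisation g t (x, y) = g (x, t y)`** when `g (x, 0) = 0`: the fundamental theorem of
calculus along `s ↦ g (x, s t y)`, whose velocity is `Dg (x, s t y) (0, t y) = t • Dg (⋯) (0, y)`.
[cite: Kosinski1993, III (3.1), proof (p. 47); Appendix (2.1)] -/
theorem smul_linearisation [CompleteSpace G] {g : E × F → G} {n : WithTop ℕ∞}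
    (hg : ContDiff ℝ n g) (hn : n ≠ 0) (hg0 : ∀ x, g (x, 0) = 0) (t : ℝ) (p : E × F) :
    t • linearisation g t p = g (p.1, t • p.2) := by
  have hd : Differentiable ℝ g := hg.differentiable hn
  -- the curve `s ↦ (x, (s t) • y)` and its velocity `(0, t • y)`
  have hγ : ∀ s : ℝ, HasDerivAt (fun s : ℝ => ((p.1, (s * t) • p.2) : E × F))
      ((0 : E), t • p.2) s := fun s => by
    have h1 : HasDerivAt (fun s : ℝ => (s * t) • p.2) ((1 * t) • p.2) s :=
      ((hasDerivAt_id s).mul_const t).smul_const p.2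
    rw [one_mul] at h1
    exact (hasDerivAt_const s p.1).prodMk h1
  have hφ : ∀ s : ℝ, HasDerivAt (fun s : ℝ => g (p.1, (s * t) • p.2))
      (t • fderiv ℝ g (p.1, (s * t) • p.2) ((0 : E), p.2)) s := fun s => by
    have h := (hd (p.1, (s * t) • p.2)).hasFDerivAt.comp_hasDerivAt s (hγ s)
    have e : fderiv ℝ g (p.1, (s * t) • p.2) ((0 : E), t • p.2) =
        t • fderiv ℝ g (p.1, (s * t) • p.2) ((0 : E), p.2) := by
      rw [show (((0 : E), t • p.2) : E × F) = t • ((0 : E), p.2) by simp, map_smul]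
    rw [e] at h
    exact h
  have hint : IntervalIntegrable (fun s : ℝ => t • fderiv ℝ g (p.1, (s * t) • p.2) ((0 : E), p.2))
      volume 0 1 :=
    ((continuous_linearisation_integrand hg hn t p).const_smul t).intervalIntegrable 0 1
  have h := integral_eq_sub_of_hasDerivAt (fun s _ => hφ s) hint
  rw [intervalIntegral.integral_smul] at h
  simp only [one_mul, zero_mul, zero_smul, hg0, sub_zero] at h
  exact h

/-- For `t ≠ 0`, `linearisation g t (x, y) = t⁻¹ g (x, t y)`. [cite: Kosinski1993, III (3.1), proof (p. 47)] -/
theorem linearisation_of_ne_zero [CompleteSpace G] {g : E × F → G} {n : WithTop ℕ∞}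
    (hg : ContDiff ℝ n g) (hn : n ≠ 0) (hg0 : ∀ x, g (x, 0) = 0) {t : ℝ} (ht : t ≠ 0)
    (p : E × F) : linearisation g t p = t⁻¹ • g (p.1, t • p.2) := by
  rw [← smul_linearisation hg hn hg0 t p, smul_smul, inv_mul_cancel₀ ht, one_smul]

/-- At `t = 1` the linearisation family is `g` itself. [cite: Kosinski1993, III (3.1), proof (p. 47)] -/
theorem linearisation_one [CompleteSpace G] {g : E × F → G} {n : WithTop ℕ∞}
    (hg : ContDiff ℝ n g) (hn : n ≠ 0) (hg0 : ∀ x, g (x, 0) = 0) (p : E × F) :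
    linearisation g 1 p = g p := by
  have h := smul_linearisation hg hn hg0 1 p
  rwa [one_smul, one_smul] at h

/-- **At `t = 0` the linearisation family is the fibrewise derivative** `y ↦ Dg (x, 0) (0, y)`.
[cite: Kosinski1993, III (3.1), proof (p. 47)] -/
theorem linearisation_zero [CompleteSpace G] (g : E × F → G) (p : E × F) :
    linearisation g 0 p = fderiv ℝ g (p.1, 0) ((0 : E), p.2) := by
  simp only [linearisation, mul_zero, zero_smul, intervalIntegral.integral_const, sub_zero,
    one_smul]

/-- The stage `t = 0` as a continuous linear map in `y`: `Dg (x, 0) ∘ (y ↦ (0, y))`. [folklore] -/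
def linearisationZeroCLM (g : E × F → G) (x : E) : F →L[ℝ] G :=
  (fderiv ℝ g (x, 0)).comp (ContinuousLinearMap.inr ℝ E F)

/-- `linearisation g 0 (x, y) = linearisationZeroCLM g x y`. [folklore] -/
theorem linearisation_zero_eq_clm [CompleteSpace G] (g : E × F → G) (x : E) (y : F) :
    linearisation g 0 (x, y) = linearisationZeroCLM g x y := by
  rw [linearisation_zero]
  rfl

/-- **Every stage of the linearisation family vanishes on `E × {0}`** (the zero section is kept
fixed). [cite: Kosinski1993, III (3.1)] -/
theorem linearisation_apply_zero (g : E × F → G) (t : ℝ) (x : E) :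
    linearisation g t (x, 0) = 0 := by
  simp only [linearisation, smul_zero]
  rw [show (((0 : E), (0 : F)) : E × F) = 0 from rfl, map_zero, intervalIntegral.integral_zero]

/-- **The linearisation family is jointly `C^∞` in `(t, x, y)` on all of `ℝ × E × F`** (including
`t = 0`), for `C^∞` `g` and finite-dimensional `E`, `F`: differentiation under the integral sign
(`contDiff_intervalIntegral`) applied to the smooth integrand
`((t, x, y), s) ↦ Dg (x, s t y) (0, y)`. [cite: Kosinski1993, III (3.1), proof (p. 47)] -/
theorem contDiff_linearisation [FiniteDimensional ℝ E] [FiniteDimensional ℝ F] [CompleteSpace G]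
    {g : E × F → G} (hg : ContDiff ℝ ∞ g) :
    ContDiff ℝ ∞ (fun q : ℝ × (E × F) => linearisation g q.1 q.2) := by
  have h1 : ContDiff ℝ ∞ (fun p : E × F => fderiv ℝ g p) := hg.fderiv_right (m := ∞) (by simp)
  have h2 : ContDiff ℝ ∞ (uncurry fun (q : ℝ × (E × F)) (s : ℝ) =>
      fderiv ℝ g (q.2.1, (s * q.1) • q.2.2) ((0 : E), q.2.2)) := by
    have hm : ContDiff ℝ ∞ (fun r : (ℝ × (E × F)) × ℝ =>
        ((r.1.2.1, (r.2 * r.1.1) • r.1.2.2) : E × F)) := by fun_prop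
    have hv : ContDiff ℝ ∞ (fun r : (ℝ × (E × F)) × ℝ => (((0 : E), r.1.2.2) : E × F)) := by
      fun_prop
    exact (h1.comp hm).clm_apply hv
  exact contDiff_intervalIntegral (n := ⊤) h2 0 1

/-- The stages of the linearisation family are `C^∞`. [folklore] -/
theorem contDiff_linearisation_stage [FiniteDimensional ℝ E] [FiniteDimensional ℝ F]
    [CompleteSpace G] {g : E × F → G} (hg : ContDiff ℝ ∞ g) (t : ℝ) :
    ContDiff ℝ ∞ (linearisation g t) :=
  (contDiff_linearisation hg).comp (contDiff_const.prodMk contDiff_id)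

/-! ### The rank computation of Kosinski III (3.1) -/

/-- **The fibre derivative of a slice embedding is injective.**  Let `f : E × F → E`,
`g : E × F → G` be differentiable at `(x, 0)` with `f (x', 0) = x'` and `g (x', 0) = 0` for all
`x'`, and suppose the differential of `ι = (f, g)` at `(x, 0)` is injective (e.g. `ι` is an
immersion there).  Then `y ↦ Dg (x, 0) (0, y)` is injective: `D₁g (x, 0) = 0` and
`D₁f (x, 0) = id`, so `Dι (x, 0) (-D₂f y, y) = (0, D₂g y)`, which forces `y = 0` when
`D₂g y = 0` (*"along `M`, `J(ι) = (I *; 0 J)`, thus `J` must be of rank `k`"*).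
[cite: Kosinski1993, III (3.1), end of proof (pp. 47–48)] -/
theorem injective_fderiv_snd_of_slice {f : E × F → E} {g : E × F → G} {x : E}
    (hf : ∀ x', f (x', 0) = x') (hg : ∀ x', g (x', 0) = 0)
    (hdf : DifferentiableAt ℝ f (x, 0)) (hdg : DifferentiableAt ℝ g (x, 0))
    (hinj : Injective (fderiv ℝ (fun p : E × F => (f p, g p)) (x, 0))) :
    Injective fun y : F => fderiv ℝ g (x, 0) ((0 : E), y) := by
  -- `D₁f (x, 0) u = u` and `D₁g (x, 0) u = 0`
  have hDf : ∀ u : E, fderiv ℝ f (x, 0) (u, 0) = u := fun u => by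
    have h1 : HasFDerivAt (fun x' : E => f (x', 0))
        ((fderiv ℝ f (x, 0)).comp (ContinuousLinearMap.inl ℝ E F)) x :=
      hdf.hasFDerivAt.comp x (hasFDerivAt_prodMk_left x (0 : F))
    have h2 : HasFDerivAt (fun x' : E => f (x', 0)) (ContinuousLinearMap.id ℝ E) x := by
      simp only [hf]
      exact hasFDerivAt_id x
    have := congrArg (fun L : E →L[ℝ] E => L u) (h1.unique h2)
    simpa using this
  have hDg : ∀ u : E, fderiv ℝ g (x, 0) (u, 0) = 0 := fun u => by
    have h1 : HasFDerivAt (fun x' : E => g (x', 0))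
        ((fderiv ℝ g (x, 0)).comp (ContinuousLinearMap.inl ℝ E F)) x :=
      hdg.hasFDerivAt.comp x (hasFDerivAt_prodMk_left x (0 : F))
    have h2 : HasFDerivAt (fun x' : E => g (x', 0)) (0 : E →L[ℝ] G) x := by
      simp only [hg]
      exact hasFDerivAt_const (0 : G) x
    have := congrArg (fun L : E →L[ℝ] G => L u) (h1.unique h2)
    simpa using this
  intro y y' hyy'
  -- apply the injective differential of `ι` to `(-D₂f (y - y'), y - y')`
  set v : F := y - y' with hv
  have hDι : fderiv ℝ (fun p : E × F => (f p, g p)) (x, 0) =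
      (fderiv ℝ f (x, 0)).prod (fderiv ℝ g (x, 0)) := hdf.fderiv_prodMk hdg
  have hsplit : ∀ (u : E) (w : F), ((u, w) : E × F) = (u, 0) + (0, w) := fun u w => by simp
  have hgv : fderiv ℝ g (x, 0) ((0 : E), v) = 0 := by
    rw [hv, show (((0 : E), y - y') : E × F) = ((0 : E), y) - ((0 : E), y') by simp, map_sub,
      sub_eq_zero]
    exact hyy'
  have key : fderiv ℝ (fun p : E × F => (f p, g p)) (x, 0)
      ((-(fderiv ℝ f (x, 0) ((0 : E), v)), v) : E × F) = 0 := by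
    rw [hDι, ContinuousLinearMap.prod_apply, hsplit (-(fderiv ℝ f (x, 0) ((0 : E), v))) v]
    simp only [map_add, hDf, hDg, zero_add, neg_add_cancel, hgv]
    rfl
  have h0 := hinj (key.trans (map_zero _).symm)
  have hv0 : v = 0 := (Prod.mk.inj h0).2
  exact sub_eq_zero.1 hv0

end Literature.Analysis.Calculus
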